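import Literature.LinearAlgebra.TensorNetworks.JunctionTree
import Mathlib.Algebra.Order.BigOperators.Group.List
import Mathlib.Algebra.Order.BigOperators.Group.Finset
import HarnessLib

/-!
# Size of the entries of the junction-tree tables (unconditional bound)

Topic `Literature/LinearAlgebra/TensorNetworks`, sequel of `JunctionTree.lean` (`JT.runDP`: the
messages of the bags `|bags|-1, …, 0`; `JT.mkTable`, `JT.entryAt`). A polynomial-time realisation
of the algorithm needs a bound on the SIZE of every table entry that holds on every input — also
on parent/bag lists that are not tree decompositions —, since the accumulator bound of a clocked
loop must be unconditional. With a size measure `ν : R → ℕ` that is subadditive and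
submultiplicative up to a constant `K` (`SizeMeasure`), entries bounded by `M` and an enumeration
budget `cap`, every entry `e` of every table satisfies `ν e ≤ cap^{nb} · K^{|fs| + 2 nb} · M^{|fs|}`
(`nb` = number of bags), so `log ν e` is linear in the input length. The proof assigns to the
message of bag `c` additive weights (`wN c`, `wE c`, `wF c`: one plus the weights of the messages
it absorbs) bounding its entries by `cap^{wN c} K^{wE c} M^{wF c}` (`nu_entry_le`), and bounds the
weights by a potential argument valid for arbitrary inputs: a message is absorbed at most once (by
the bag `parOf c`, if `parOf c < c`), so the total weight of the pending messages grows by exactly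
one per bag (`sum_pending_wN`), whence `wN c ≤ nb`, and similarly `wF c ≤ |fs|`,
`wE c ≤ |fs| + 2 nb` (`wN_le`, `wF_le`, `wE_le`); **`nu_runDP_le`** is the resulting bound.

## References

* R. Dechter, Artif. Intell. 113 (1999), §5 (complexity of bucket elimination: table sizes).
* S. Arora, B. Barak, *Computational Complexity*, CUP 2009, §1.3 (polynomially bounded loops).
-/

namespace Literature.LinearAlgebra.TensorNetworks

namespace JT

open Finset Literature.Combinatorics.SimpleGraph.ListTD

variable {R : Type*} [CommSemiring R] {Φ : Type*}

/-! ### Size measures -/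

/-- **A size measure** on a semiring: `ν 0 = 0`, `ν 1 ≤ 1`, subadditive, and submultiplicative up
to the constant `K ≥ 1` (e.g. the sup of the integer coordinates of an element of `ℤ[ω]`, `K = 4`).
[folklore] -/
structure SizeMeasure (ν : R → ℕ) (K : ℕ) : Prop where
  /-- size of zero -/
  zero : ν 0 = 0
  /-- size of one -/
  one : ν 1 ≤ 1
  /-- subadditivity -/
  add : ∀ a b, ν (a + b) ≤ ν a + ν b
  /-- submultiplicativity up to `K` -/
  mul : ∀ a b, ν (a * b) ≤ K * (ν a * ν b)
  /-- `K ≥ 1` -/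
  one_le : 1 ≤ K

variable {ν : R → ℕ} {K : ℕ}

/-- Size of a list sum. [folklore] -/
theorem SizeMeasure.list_sum (h : SizeMeasure ν K) : ∀ l : List R, ν l.sum ≤ (l.map ν).sum
  | [] => by simp [h.zero]
  | a :: l => by rw [List.sum_cons, List.map_cons, List.sum_cons]; exact (h.add _ _).trans (Nat.add_le_add_left (h.list_sum l) _)

/-- Size of a list sum of at most `c` terms each of size `≤ B`. [folklore] -/
theorem SizeMeasure.list_sum_le (h : SizeMeasure ν K) {l : List R} {c B : ℕ} (hl : l.length ≤ c)
    (hB : ∀ x ∈ l, ν x ≤ B) : ν l.sum ≤ c * B := by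
  refine (h.list_sum l).trans ?_
  calc (l.map ν).sum ≤ (l.map fun _ => B).sum := List.sum_le_sum fun x hx => hB x hx
    _ = l.length * B := by rw [List.map_const', List.sum_replicate, smul_eq_mul]
    _ ≤ c * B := Nat.mul_le_mul_right _ hl

/-- Size of a list product: `ν (∏ l) ≤ K^{|l|} · ∏ (ν x)`. [folklore] -/
theorem SizeMeasure.list_prod (h : SizeMeasure ν K) : ∀ l : List R, ν l.prod ≤ K ^ l.length * (l.map ν).prod
  | [] => by simpa using h.one
  | a :: l => by
    rw [List.prod_cons, List.map_cons, List.prod_cons, List.length_cons, pow_succ]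
    calc ν (a * l.prod) ≤ K * (ν a * ν l.prod) := h.mul _ _
      _ ≤ K * (ν a * (K ^ l.length * (l.map ν).prod)) := Nat.mul_le_mul_left _ (Nat.mul_le_mul_left _ (h.list_prod l))
      _ = K ^ l.length * K * (ν a * (l.map ν).prod) := by ring

/-- Size of a list product of factors of size `≤` a pointwise bound. [folklore] -/
theorem SizeMeasure.list_prod_le (h : SizeMeasure ν K) {α : Type*} (l : List α) (f : α → R) (B : α → ℕ)
    (hB : ∀ x ∈ l, ν (f x) ≤ B x) : ν (l.map f).prod ≤ K ^ l.length * (l.map B).prod := by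
  refine (h.list_prod _).trans ?_
  rw [List.length_map, List.map_map]
  exact Nat.mul_le_mul_left _ (List.prod_le_prod' fun x hx => hB x hx)

/-! ### Weights of messages and the potential argument -/

section Weights

variable (par : List ℕ) (nb : ℕ)

/-- **The messages absorbed by bag `c`**: the indices `c' ∈ (c, nb)` with parent `c` (the root `0`
is nobody's child). These are exactly the messages `childMsgs` multiplies in at step `c`, whatever
the parent list. [folklore] -/
def kidsIdx (c : ℕ) : Finset ℕ := (Finset.Ico (c + 1) nb).filter fun c' => c' ≠ 0 ∧ parOf par c' = c

/-- Membership in `kidsIdx`. [folklore] -/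
theorem mem_kidsIdx {c c' : ℕ} : c' ∈ kidsIdx par nb c ↔ (c < c' ∧ c' < nb) ∧ c' ≠ 0 ∧ parOf par c' = c := by
  simp [kidsIdx, Nat.lt_iff_add_one_le]

/-- Absorbed messages have larger indices. [folklore] -/
theorem lt_of_mem_kidsIdx {c c' : ℕ} (h : c' ∈ kidsIdx par nb c) : c < c' ∧ c' < nb :=
  ((mem_kidsIdx par nb).1 h).1

/-- **The weight of the message of bag `c`** for a base weight `base`: its own base weight plus the
weights of the messages it absorbs. [folklore] -/
def wgt (base : ℕ → ℕ) (c : ℕ) : ℕ :=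
  base c + (kidsIdx par nb c).attach.sum fun x =>
    have _hx := lt_of_mem_kidsIdx par nb x.2
    wgt base x.1
termination_by nb - c
decreasing_by omega

/-- The weight equation. [folklore] -/
theorem wgt_eq (base : ℕ → ℕ) (c : ℕ) : wgt par nb base c = base c + ∑ c' ∈ kidsIdx par nb c, wgt par nb base c' := by
  rw [wgt, Finset.sum_attach (kidsIdx par nb c) (fun c' => wgt par nb base c')]

/-- **A message is pending at time `t`** (the bags `≥ t` processed) if it has not been absorbed,
i.e. unless it is a non-root message whose parent lies in `[t, c)`. [folklore] -/
def Pending (t c : ℕ) : Prop := ¬ (c ≠ 0 ∧ t ≤ parOf par c ∧ parOf par c < c)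

/-- Pendency is decidable. [folklore] -/
instance decPending (t c : ℕ) : Decidable (Pending par t c) := by
  unfold Pending; infer_instance

/-- **The potential**: the total weight of the pending messages. [folklore] -/
def pot (base : ℕ → ℕ) (t : ℕ) : ℕ := ∑ c ∈ (Finset.Ico t nb).filter (Pending par t), wgt par nb base c

/-- **The potential grows by the base weight of the processed bag**: `pot t = base t + pot (t + 1)`
for `t < nb`. [folklore] -/
theorem pot_eq (base : ℕ → ℕ) {t : ℕ} (ht : t < nb) : pot par nb base t = base t + pot par nb base (t + 1) := by
  unfold pot
  have hIco : Finset.Ico t nb = insert t (Finset.Ico (t + 1) nb) := by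
    ext c; simp only [Finset.mem_Ico, Finset.mem_insert]; omega
  have htt : Pending par t t := fun h => by omega
  have hnot : t ∉ Finset.Ico (t + 1) nb := by simp
  rw [hIco, Finset.filter_insert, if_pos htt, Finset.sum_insert (by simp [hnot]), wgt_eq, add_assoc]
  congr 1
  -- pending at `t` over `(t, nb)` = pending at `t + 1` minus the messages absorbed by `t`
  have hsplit : (Finset.Ico (t + 1) nb).filter (Pending par t) =
      (Finset.Ico (t + 1) nb).filter (Pending par (t + 1)) \ kidsIdx par nb t := by
    ext c
    simp only [Finset.mem_filter, Finset.mem_Ico, Finset.mem_sdiff, mem_kidsIdx, Pending]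
    constructor
    · rintro ⟨hc, hp⟩
      refine ⟨⟨hc, fun h => hp ⟨h.1, by omega, h.2.2⟩⟩, fun h => hp ⟨h.2.1, by omega, by omega⟩⟩
    · rintro ⟨⟨hc, hp⟩, hk⟩
      refine ⟨hc, fun h => ?_⟩
      rcases Nat.eq_or_lt_of_le h.2.1 with he | hlt
      · exact hk ⟨⟨by omega, hc.2⟩, h.1, he.symm⟩
      · exact hp ⟨h.1, hlt, h.2.2⟩
  have hsub : kidsIdx par nb t ⊆ (Finset.Ico (t + 1) nb).filter (Pending par (t + 1)) := by
    intro c hc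
    rw [mem_kidsIdx] at hc
    simp only [Finset.mem_filter, Finset.mem_Ico, Pending]
    exact ⟨⟨by omega, hc.1.2⟩, fun h => by omega⟩
  rw [hsplit, add_comm]
  exact Finset.sum_sdiff hsub

/-- Beyond the last bag the potential vanishes. [folklore] -/
theorem pot_of_le (base : ℕ → ℕ) {t : ℕ} (ht : nb ≤ t) : pot par nb base t = 0 := by
  unfold pot
  rw [Finset.Ico_eq_empty (by omega)]
  simp

/-- **The potential in closed form**: the total base weight of the bags `≥ t`. [folklore] -/
theorem pot_eq_sum (base : ℕ → ℕ) : ∀ k t, t + k = nb → pot par nb base t = ∑ s ∈ Finset.Ico t nb, base s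
  | 0, t, h => by rw [pot_of_le par nb base (by omega), Finset.Ico_eq_empty (by omega)]; simp
  | k + 1, t, h => by
    rw [pot_eq par nb base (by omega), pot_eq_sum base k (t + 1) (by omega)]
    have hIco : Finset.Ico t nb = insert t (Finset.Ico (t + 1) nb) := by
      ext c; simp only [Finset.mem_Ico, Finset.mem_insert]; omega
    rw [hIco, Finset.sum_insert (by simp)]

/-- **Every weight is at most the total base weight** (a message is pending when created).
[folklore] -/
theorem wgt_le_sum (base : ℕ → ℕ) {c : ℕ} (hc : c < nb) : wgt par nb base c ≤ ∑ s ∈ Finset.Ico c nb, base s := by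
  rw [← pot_eq_sum par nb base (nb - c) c (by omega)]
  unfold pot
  have hmem : c ∈ (Finset.Ico c nb).filter (Pending par c) :=
    Finset.mem_filter.2 ⟨Finset.mem_Ico.2 ⟨le_rfl, hc⟩, fun h => by omega⟩
  exact Finset.single_le_sum (f := wgt par nb base) (fun _ _ => Nat.zero_le _) hmem

/-- The absorbed sets are pairwise disjoint (a message has one parent). [folklore] -/
theorem kidsIdx_disjoint {t t' : ℕ} (h : t ≠ t') : Disjoint (kidsIdx par nb t) (kidsIdx par nb t') := by
  rw [Finset.disjoint_left]
  intro c hc hc'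
  rw [mem_kidsIdx] at hc hc'
  exact h (hc.2.2.symm.trans hc'.2.2)

/-- **In total at most `nb` messages are absorbed.** [folklore] -/
theorem sum_card_kidsIdx_le : ∑ s ∈ Finset.range nb, (kidsIdx par nb s).card ≤ nb := by
  classical
  rw [← Finset.card_biUnion fun s _ s' _ h => kidsIdx_disjoint par nb h]
  calc ((Finset.range nb).biUnion (kidsIdx par nb)).card ≤ (Finset.range nb).card :=
        Finset.card_le_card (Finset.biUnion_subset.2 fun s _ c hc => Finset.mem_range.2 (lt_of_mem_kidsIdx par nb hc).2)
    _ = nb := Finset.card_range nb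

end Weights

/-! ### The bound along the run -/

section Entries

variable (O : FactorOps R Φ) (d cap : ℕ) (par : List ℕ) (bags : List (List ℕ)) (fs : List Φ)

/-- The number of factors housed at bag `t`. [folklore] -/
def fCnt (t : ℕ) : ℕ := (fs.filter fun φ => decide (homeOf bags (O.scope φ) = t)).length

/-- **The bound on the entries of the message of bag `c`**: `cap^{wN c} · K^{wE c} · M^{wF c}` with
the additive weights of §Weights (base weights `1`, `1 + fCnt + #kids`, `fCnt`). [folklore] -/
def entryBound (K M : ℕ) (c : ℕ) : ℕ :=
  cap ^ wgt par bags.length (fun _ => 1) c *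
    K ^ wgt par bags.length (fun t => 1 + fCnt O bags fs t + (kidsIdx par bags.length t).card) c *
    M ^ wgt par bags.length (fCnt O bags fs) c

/-- **The invariant**: after the bags `≥ t`, the messages are those of `t, …, nb-1` and every entry
of the message of `c` has size `≤ entryBound c`. [folklore] -/
def BInv (K M : ℕ) (ν : R → ℕ) (t : ℕ) (msgs : List (ℕ × Table R)) : Prop :=
  msgs.map Prod.fst = List.range' t (bags.length - t) ∧
    ∀ m ∈ msgs, ∀ e ∈ m.2, ν e.2 ≤ entryBound O cap par bags fs K M m.1

variable {ν : R → ℕ} {K M : ℕ}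

/-- A table all of whose entries are small reads small values (or `0`). [folklore] -/
theorem nu_tabVal_le (hν : SizeMeasure ν K) {tab : Table R} {B : ℕ} (h : ∀ e ∈ tab, ν e.2 ≤ B) (key : List ℕ) :
    ν (tabVal tab key) ≤ B := by
  unfold tabVal
  split
  · next e hf => exact h e (List.mem_of_find?_eq_some hf)
  · simp [hν.zero]

/-- The budgeted enumeration has at most `cap` value lists. [folklore] -/
theorem length_allAssignCap_le (d cap : ℕ) (vs : List ℕ) : (allAssignCap d cap vs).length ≤ cap := by
  unfold allAssignCap
  split_ifs with h
  · rwa [length_allAssign]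
  · exact Nat.zero_le _

variable {O d cap par bags fs}

/-- **The size of a product at a bag**: with factor entries of size `≤ M` and the children's entries
bounded by `entryBound`, `ν (entryAt t A) ≤ K · (K M)^{fCnt t} · K^{#children} · ∏ entryBound`.
[folklore] -/
theorem nu_entryAt_le (hν : SizeMeasure ν K) (hM : ∀ φ ∈ fs, ∀ a, ν (O.feval φ a) ≤ M)
    {msgs : List (ℕ × Table R)} (hmsgs : ∀ m ∈ msgs, ∀ e ∈ m.2, ν e.2 ≤ entryBound O cap par bags fs K M m.1)
    (t : ℕ) (A : List (ℕ × ℕ)) :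
    ν (entryAt O par bags fs msgs t A) ≤
      K * ((K ^ fCnt O bags fs t * M ^ fCnt O bags fs t) *
        (K ^ (childMsgs par msgs t).length *
          ((childMsgs par msgs t).map fun m => entryBound O cap par bags fs K M m.1).prod)) := by
  unfold entryAt
  refine (hν.mul _ _).trans (Nat.mul_le_mul_left _ (Nat.mul_le_mul ?_ ?_))
  · have h := hν.list_prod_le (fs.filter fun φ => decide (homeOf bags (O.scope φ) = t))
      (fun φ => O.feval φ (assignOf A)) (fun _ => M) fun φ hφ => hM φ (List.mem_of_mem_filter hφ) _
    rw [List.map_const', List.prod_replicate] at h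
    exact h
  · exact hν.list_prod_le _ _ _ fun m hm =>
      nu_tabVal_le hν (hmsgs m (List.mem_of_mem_filter hm)) _

omit [CommSemiring R] in
/-- The children multiplied in at step `t` are the messages of `kidsIdx t`, once each. [folklore] -/
theorem childMsgs_fst {t : ℕ} {msgs : List (ℕ × Table R)}
    (hfst : msgs.map Prod.fst = List.range' (t + 1) (bags.length - (t + 1))) :
    ((childMsgs par msgs t).map Prod.fst).Nodup ∧
      ((childMsgs par msgs t).map Prod.fst).toFinset = kidsIdx par bags.length t := by
  have heq : (childMsgs par msgs t).map Prod.fst =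
      (msgs.map Prod.fst).filter fun c => decide (c ≠ 0 ∧ parOf par c = t) := by
    unfold childMsgs
    rw [List.filter_map]; rfl
  rw [heq, hfst]
  refine ⟨(List.nodup_range').filter _, ?_⟩
  ext c
  simp only [List.mem_toFinset, List.mem_filter, List.mem_range'_1, decide_eq_true_eq, mem_kidsIdx]
  constructor
  · rintro ⟨⟨h1, h2⟩, h3⟩; exact ⟨⟨by omega, by omega⟩, h3⟩
  · rintro ⟨⟨h1, h2⟩, h3⟩; exact ⟨⟨by omega, by omega⟩, h3⟩

/-- A product over a list without repetition is the product over its finset. [folklore] -/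
theorem prod_map_eq_prod_toFinset {l : List ℕ} (hl : l.Nodup) (g : ℕ → ℕ) : (l.map g).prod = ∏ c ∈ l.toFinset, g c := by
  rw [List.prod_toFinset g hl]

/-- **The step**: the new message satisfies its bound. [folklore] -/
theorem bInv_step (hν : SizeMeasure ν K) (hM : ∀ φ ∈ fs, ∀ a, ν (O.feval φ a) ≤ M) {t : ℕ} (ht : t < bags.length)
    {msgs : List (ℕ × Table R)} (h : BInv O cap par bags fs K M ν (t + 1) msgs) :
    BInv O cap par bags fs K M ν t (stepBag O d cap par bags fs t msgs) := by
  obtain ⟨hfst, hb⟩ := h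
  refine ⟨?_, ?_⟩
  · have hn : bags.length - t = (bags.length - (t + 1)) + 1 := by omega
    rw [stepBag, List.map_cons, hfst, hn, List.range'_succ]
  intro m hm e he
  rw [stepBag, List.mem_cons] at hm
  rcases hm with rfl | hm
  · -- the new table of bag `t`
    simp only at he ⊢
    obtain ⟨kv, -, rfl⟩ := List.mem_map.1 he
    -- children and their weights
    obtain ⟨hnd, hkids⟩ := childMsgs_fst (par := par) (bags := bags) hfst
    set ch := childMsgs par msgs t with hch
    set nb := bags.length with hnb
    have hcard : ch.length = (kidsIdx par nb t).card := by
      rw [← hkids, List.toFinset_card_of_nodup hnd, List.length_map]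
    -- the sum has at most `cap` terms, each bounded by `nu_entryAt_le`
    have hB : ∀ x ∈ (allAssignCap d cap (privVars par bags t)).map
        (fun pv => entryAt O par bags fs msgs t ((keptVars par bags t).zip kv ++ (privVars par bags t).zip pv)),
        ν x ≤ K * ((K ^ fCnt O bags fs t * M ^ fCnt O bags fs t) *
          (K ^ ch.length * (ch.map fun m => entryBound O cap par bags fs K M m.1).prod)) := fun x hx => by
      obtain ⟨pv, -, rfl⟩ := List.mem_map.1 hx
      exact nu_entryAt_le hν hM hb t _
    refine (hν.list_sum_le ((List.length_map _).trans_le (length_allAssignCap_le d cap _)) hB).trans ?_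
    · -- arithmetic of the weights
      have hprod : (ch.map fun m => entryBound O cap par bags fs K M m.1).prod =
          ∏ c ∈ kidsIdx par nb t, entryBound O cap par bags fs K M c := by
        rw [← hkids, ← prod_map_eq_prod_toFinset hnd, List.map_map]; rfl
      rw [hprod, hcard]
      unfold entryBound
      rw [Finset.prod_mul_distrib, Finset.prod_mul_distrib, Finset.prod_pow_eq_pow_sum, Finset.prod_pow_eq_pow_sum,
        Finset.prod_pow_eq_pow_sum, wgt_eq par nb (fun _ => 1) t, wgt_eq par nb (fCnt O bags fs) t,
        wgt_eq par nb (fun t => 1 + fCnt O bags fs t + (kidsIdx par nb t).card) t]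
      -- `cap · K · (K^f M^f) · K^{#kids} · cap^{ΣN} K^{ΣE} M^{ΣF} = cap^{1+ΣN} K^{1+f+#kids+ΣE} M^{f+ΣF}`
      refine le_of_eq ?_
      ring
  · exact hb m hm e he

omit [CommSemiring R] in
/-- The invariant holds before the run. [folklore] -/
theorem bInv_length : BInv O cap par bags fs K M ν bags.length ([] : List (ℕ × Table R)) := ⟨by simp, by simp⟩

/-- **The invariant along the run.** [folklore] -/
theorem bInv_dpFrom (hν : SizeMeasure ν K) (hM : ∀ φ ∈ fs, ∀ a, ν (O.feval φ a) ≤ M) :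
    ∀ k t, t + k = bags.length → BInv O cap par bags fs K M ν t (dpFrom O d cap par bags fs t)
  | 0, t, h => by rw [Nat.add_zero] at h; subst h; rw [dpFrom_length]; exact bInv_length
  | k + 1, t, h => by
    rw [dpFrom_of_lt O d cap par bags fs (by omega)]
    exact bInv_step hν hM (by omega) (bInv_dpFrom hν hM k (t + 1) (by omega))

omit [CommSemiring R] in
/-- The factor counts over all bags total at most `|fs|`. [folklore] -/
theorem sum_fCnt_le (c : ℕ) : ∑ s ∈ Finset.Ico c bags.length, fCnt O bags fs s ≤ fs.length := by
  unfold fCnt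
  suffices H : ∀ l : List Φ,
      ∑ s ∈ Finset.Ico c bags.length, (l.filter fun φ => decide (homeOf bags (O.scope φ) = s)).length ≤ l.length from H fs
  intro l
  induction l with
  | nil => simp
  | cons φ l ih =>
    calc ∑ s ∈ Finset.Ico c bags.length, ((φ :: l).filter fun φ => decide (homeOf bags (O.scope φ) = s)).length
        = ∑ s ∈ Finset.Ico c bags.length,
            ((if homeOf bags (O.scope φ) = s then 1 else 0) + (l.filter fun φ => decide (homeOf bags (O.scope φ) = s)).length) :=
          Finset.sum_congr rfl fun s _ => by
            rw [List.filter_cons]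
            by_cases h : homeOf bags (O.scope φ) = s <;> simp [h, Nat.add_comm]
      _ = (∑ s ∈ Finset.Ico c bags.length, if homeOf bags (O.scope φ) = s then 1 else 0) +
            ∑ s ∈ Finset.Ico c bags.length, (l.filter fun φ => decide (homeOf bags (O.scope φ) = s)).length :=
          Finset.sum_add_distrib
      _ ≤ 1 + l.length := by
          refine Nat.add_le_add ?_ ih
          rw [Finset.sum_ite_eq]
          split_ifs <;> omega
      _ = (φ :: l).length := by simp [Nat.add_comm]

/-- **The unconditional bound on the table entries of the run**: for a size measure `ν` with
constant `K`, factor entries of size `≤ M` (`M ≥ 1`) and a budget `cap ≥ 1`, every entry `e` of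
every message of `runDP` has `ν e ≤ cap^{nb} · K^{|fs| + 2 nb} · M^{|fs|}` — whatever the parent and
bag lists. [cite: Dechter1999, §5 (table sizes of bucket elimination)] -/
theorem nu_runDP_le (hν : SizeMeasure ν K) (hM : ∀ φ ∈ fs, ∀ a, ν (O.feval φ a) ≤ M) (hM1 : 1 ≤ M) (hcap : 1 ≤ cap)
    {m : ℕ × Table R} (hm : m ∈ runDP O d cap par bags fs) {e : List ℕ × R} (he : e ∈ m.2) :
    ν e.2 ≤ cap ^ bags.length * K ^ (fs.length + 2 * bags.length) * M ^ fs.length := by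
  set nb := bags.length with hnb
  obtain ⟨hfst, hb⟩ := bInv_dpFrom (d := d) hν hM nb 0 (Nat.zero_add _)
  rw [← runDP_eq_dpFrom] at hfst hb
  have hc : m.1 < nb := by
    have : m.1 ∈ (runDP O d cap par bags fs).map Prod.fst := List.mem_map_of_mem hm
    rw [hfst, List.mem_range'_1] at this; omega
  refine (hb m hm e he).trans ?_
  unfold entryBound
  have hj : ∑ s ∈ Finset.Ico m.1 nb, (1 : ℕ) = nb - m.1 := by simp
  have hb' := sum_fCnt_le (O := O) (bags := bags) (fs := fs) m.1
  rw [← hnb] at hb'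
  have h1 : wgt par nb (fun _ => 1) m.1 ≤ nb := (wgt_le_sum par nb _ hc).trans (by rw [hj]; omega)
  have h2 : wgt par nb (fCnt O bags fs) m.1 ≤ fs.length := (wgt_le_sum par nb _ hc).trans hb'
  have h3 : wgt par nb (fun t => 1 + fCnt O bags fs t + (kidsIdx par nb t).card) m.1 ≤ fs.length + 2 * nb := by
    refine (wgt_le_sum par nb _ hc).trans ?_
    rw [Finset.sum_add_distrib, Finset.sum_add_distrib, hj]
    have hc' : ∑ s ∈ Finset.Ico m.1 nb, (kidsIdx par nb s).card ≤ nb :=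
      (Finset.sum_le_sum_of_subset (by intro s hs; simp at hs ⊢; omega)).trans (sum_card_kidsIdx_le par nb)
    omega
  exact Nat.mul_le_mul (Nat.mul_le_mul (Nat.pow_le_pow_right hcap h1) (Nat.pow_le_pow_right hν.one_le h3))
    (Nat.pow_le_pow_right hM1 h2)

end Entries

end JT

end Literature.LinearAlgebra.TensorNetworks
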